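import Summits.CriticalPhenomena.SAWScalingLimit.Theorems.SAWDefectDecoherenceObservableToSLERCarvedReductionSqueezeInnerOneSided
import Summits.CriticalPhenomena.SAWScalingLimit.Theorems.SAWDefectDecoherenceObservableToSLERCarvedReductionSqueezeBoundaryLC
import Summits.CriticalPhenomena.SAWScalingLimit.Theorems.SAWDefectDecoherenceObservableToSLERCarvedReductionSqueezeJordanApprox
import Literature.Probability.RandomPlanarGeometry.ConformalMapRiemannProofs
import Literature.Probability.RandomPlanarGeometry.HalfPlaneFillProofs
import Literature.Probability.RandomPlanarGeometry.ChordalCurveFamily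
import HarnessLib

/-!
# Preparation of the limit bulk: translate, frontier of a component, disc uniformizer, far
# one-sided points (piece (K4p) of stub 5a4″ `stub_carvedReduction_squeezeSolid`)

Piece of stub 5a4″ `stub_carvedReduction_squeezeSolid`
(`TwoPieceAdmRestrictionLimit → MovingCarvingSqueezeP FatAnchoredClassZeroSolid`) of the line
`bridge-gate-renewal` (r11) of the crux `SAWDefectDecoherence.ObservableToSLER`
(stmt-CriticalPhenomena-14005; twin T-A `stub_carvedReduction_squeezeGeometry` of
stmt-CriticalPhenomena-10472), repaired inner-approximant contract `InnerApproximant2`.  The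
assembly (K4) of the inner Jordan approximant `M'` of the limit bulk
`Ω = ((D - τ) ∖ ⋃ K)`-component of `b₀` consumes four elementary preparations, proved here:

* `stub_carvedReduction_translate` — the translate `D - τ` of a Dobrushin domain is a Dobrushin
  domain with the same marks and the translated loop and marked points
  (`MarkedDomain.map (Homeomorph.subRight τ)`);
* `stub_carvedReduction_componentFrontier` — the frontier of a component of an open set `U` lies
  in the frontier of `U` (so `∂Ω ⊆ ∂(D - τ) ∪ ⋃ K`);
* `stub_carvedReduction_bulk` — `Ω` is open, bounded, connected with preconnected complement,
  satisfies the uniform-continuum clause `hlc` (`boundaryLC_component`), is simply connected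
  (`isSimplyConnected_of_isConnected_compl_holds`), hence carries a disc uniformizer
  `ψ : 𝔻 → Ω` (Riemann mapping theorem `exists_conformalEquiv_ball_holds`) whose extension
  `extendFrom 𝔻 ψ` is continuous on the closed disc and is the limit of `ψ` at every point
  (Carathéodory–Pommerenke `ConformalEquiv.continuousOn_extendFrom_of_lc`);
* `stub_carvedReduction_farOneSided` — FAR BOUNDARY POINTS ARE ONE-SIDED: if `Ω ⊆ D` has
  preconnected complement and `D ∖ F ⊆ Ω` for a set `F` ("no long fingers"), every `w ∈ ∂D` with
  `ball w r` disjoint from `F` lies on `∂Ω`, `Ωᶜ ∖ {w}` is connected (Schoenflies presentation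
  `stub_carvedReduction_jordanApprox` + `isConnected_compl_diff_of_far`), so `w` has at most one
  preimage on the unit circle under the extended uniformizer
  (`stub_carvedReduction_oneSidedInjective`).

Sources: Ch. Pommerenke, Boundary Behaviour of Conformal Maps (1992), Thm. 2.1, Thm. 2.6,
§2.3 Cor. 2.8; J. B. Conway, Functions of One Complex Variable I (1978), Thm. VIII.2.2.
-/

noncomputable section

open scoped Topology
open Filter Set Metric Function Bornology
open Literature.Probability.RandomPlanarGeometry

namespace Summit.CriticalPhenomena.SAWScalingLimit.Theorems.ObservableToSLER.Squeeze

/-! ### (K4p.1) the translate of a Dobrushin domain -/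

/-- **Registered sub-goal `stub_carvedReduction_translate`** (crux item stmt-CriticalPhenomena-14005,
stub 5a4″ `stub_carvedReduction_squeezeSolid`, piece (K4p.1) TRANSLATE): the translate `D - τ` of a
Dobrushin domain is a Dobrushin domain with carrier `(· - τ) '' D`, the marks of `D`, boundary loop
`t ↦ D.boundary t - τ` and marked points `D.pt i - τ` — the image of `D` under the homeomorphism
`Homeomorph.subRight τ` of the plane. [folklore] -/
theorem stub_carvedReduction_translate :
    ∀ (D : DobrushinDomain) (τ : ℂ), ∃ Dτ : DobrushinDomain,
      Dτ.carrier = (fun z => z - τ) '' D.carrier ∧ Dτ.mark = D.mark ∧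
        (∀ t, Dτ.boundary t = D.boundary t - τ) ∧ ∀ i, Dτ.pt i = D.pt i - τ := by
  intro D τ
  exact ⟨D.map (Homeomorph.subRight τ), rfl, rfl, fun t => rfl, fun i => rfl⟩

/-! ### (K4p.2) the frontier of a component of an open set -/

/-- **Registered sub-goal `stub_carvedReduction_componentFrontier`** (crux item
stmt-CriticalPhenomena-14005, stub 5a4″ `stub_carvedReduction_squeezeSolid`, piece (K4p.2)
COMPONENT FRONTIER): the frontier of a connected component of an open set `U ⊆ ℂ` lies in the
frontier of `U` (a frontier point of the component is not in `U`, since components of open sets are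
open and absorb balls, and it is in the closure of `U`). [folklore] -/
theorem stub_carvedReduction_componentFrontier :
    ∀ (U : Set ℂ) (x : ℂ), IsOpen U → frontier (connectedComponentIn U x) ⊆ frontier U := by
  intro U x hU z hz
  have h1 : z ∈ Uᶜ := by
    have h := Literature.Topology.PlaneTopology.Janiszewski.frontier_connectedComponentIn_subset
      hU.isClosed_compl x
    rw [compl_compl] at h
    exact h hz
  have h2 : z ∈ closure U :=
    closure_mono (connectedComponentIn_subset U x) (frontier_subset_closure hz)
  rw [hU.frontier_eq]
  exact ⟨h2, h1⟩

/-! ### (K4p.3) the limit bulk and its disc uniformizer -/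

/-- **Registered sub-goal `stub_carvedReduction_bulk`** (crux item stmt-CriticalPhenomena-14005,
stub 5a4″ `stub_carvedReduction_squeezeSolid`, piece (K4p.3) THE BULK UNIFORMIZER): the component
`Ω` of `b₀` in a Jordan domain minus finitely many compact convex sets, with connected complement,
is open, bounded, connected with preconnected complement, satisfies the uniform-continuum clause
`hlc`, and carries a conformal equivalence `ψ : 𝔻 → Ω` whose extension `extendFrom 𝔻 ψ` is
continuous on the closed disc, agrees with `ψ` on `𝔻`, and is the limit of `ψ` at every point of
the closed disc. [cite: PommerenkeBBCM1992, Thm. 2.1] -/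
theorem stub_carvedReduction_bulk :
    ∀ (D : DobrushinDomain) (m : ℕ) (K : Fin m → Set ℂ) (b₀ : ℂ),
      (∀ k, IsCompact (K k) ∧ Convex ℝ (K k)) →
      b₀ ∈ D.carrier \ ⋃ k, K k →
      IsConnected (connectedComponentIn (D.carrier \ ⋃ k, K k) b₀)ᶜ →
      let Ω : Set ℂ := connectedComponentIn (D.carrier \ ⋃ k, K k) b₀
      IsOpen Ω ∧ IsBounded Ω ∧ IsConnected Ω ∧ IsPreconnected Ωᶜ ∧
        (∀ ε > (0 : ℝ), ∃ δ > (0 : ℝ), ∀ a ∈ frontier Ω, ∀ b ∈ frontier Ω, dist a b < δ →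
          ∃ σ ⊆ Ωᶜ, IsCompact σ ∧ IsPreconnected σ ∧ a ∈ σ ∧ b ∈ σ ∧ σ ⊆ closedBall a ε) ∧
        ∃ ψ : ConformalEquiv (ball (0 : ℂ) 1) Ω,
          ContinuousOn (extendFrom (ball 0 1) ψ) (closedBall (0 : ℂ) 1) ∧
          (∀ x ∈ ball (0 : ℂ) 1, extendFrom (ball 0 1) ψ x = ψ x) ∧
          ∀ x ∈ closedBall (0 : ℂ) 1, Tendsto ψ (𝓝[ball 0 1] x) (𝓝 (extendFrom (ball 0 1) ψ x)) := by
  intro D m K b₀ hK hb₀ hcompl Ω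
  have hUo : IsOpen (D.carrier \ ⋃ k, K k) :=
    D.isOpen.sdiff (isClosed_iUnion_of_finite fun k => (hK k).1.isClosed)
  have hΩo : IsOpen Ω := hUo.connectedComponentIn
  have hΩD : Ω ⊆ D.carrier := (connectedComponentIn_subset _ _).trans Set.sdiff_subset
  have hΩb : IsBounded Ω := D.isBounded.subset hΩD
  have hΩc : IsConnected Ω := isConnected_connectedComponentIn_iff.2 hb₀
  have hlc : ∀ ε > (0 : ℝ), ∃ δ > (0 : ℝ), ∀ a ∈ frontier Ω, ∀ b ∈ frontier Ω, dist a b < δ →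
      ∃ σ ⊆ Ωᶜ, IsCompact σ ∧ IsPreconnected σ ∧ a ∈ σ ∧ b ∈ σ ∧ σ ⊆ closedBall a ε :=
    boundaryLC_component D.toJordanDomain K (fun k => (hK k).1) (fun k => (hK k).2) b₀
  -- `Ωᶜ` is unbounded (else `univ = Ω ∪ Ωᶜ` would be bounded), so `Ω` is simply connected
  have hΩcu : ¬ IsBounded Ωᶜ := fun h =>
    NormedSpace.unbounded_univ ℝ ℂ (by rw [← union_compl_self Ω]; exact hΩb.union h)
  have hsc : IsSimplyConnected Ω :=
    isSimplyConnected_of_isConnected_compl_holds hΩo hΩc hcompl hΩcu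
  have hne : Ω ≠ univ := fun h => NormedSpace.unbounded_univ ℝ ℂ (h ▸ hΩb)
  obtain ⟨φ⟩ := exists_conformalEquiv_ball_holds (U := Ω) hΩo hsc hne
  exact ⟨hΩo, hΩb, hΩc, hcompl.isPreconnected, hlc, φ.symm,
    φ.symm.continuousOn_extendFrom_of_lc hΩo hΩb hlc⟩

/-! ### (K4p.4) far boundary points are one-sided -/

/-- **Registered sub-goal `stub_carvedReduction_farOneSided`** (crux item stmt-CriticalPhenomena-14005,
stub 5a4″ `stub_carvedReduction_squeezeSolid`, piece (K4p.4) FAR POINTS ARE ONE-SIDED): let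
`Ω ⊆ D` be open and bounded with preconnected complement and the uniform-continuum clause `hlc`,
`ψ : 𝔻 → Ω` a conformal equivalence, and suppose `D ∖ F ⊆ Ω` (no long fingers off `F`).  Then every
frontier point `w` of `D` with `ball w r` disjoint from `F` is a frontier point of `Ω` with at most
one preimage on the unit circle under `extendFrom 𝔻 ψ`: near `w` the set `Ω` agrees with the
Schoenflies disc `D = H(𝔻)`, so `Ωᶜ ∖ {w}` is connected. [cite: PommerenkeBBCM1992, Thm. 2.6] -/
theorem stub_carvedReduction_farOneSided :
    ∀ (D : DobrushinDomain) (Ω F : Set ℂ) (ψ : ConformalEquiv (ball (0 : ℂ) 1) Ω) (r : ℝ),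
      Ω ⊆ D.carrier → IsOpen Ω → IsBounded Ω → IsPreconnected Ωᶜ →
      (∀ ε > (0 : ℝ), ∃ δ > (0 : ℝ), ∀ a ∈ frontier Ω, ∀ b ∈ frontier Ω, dist a b < δ →
        ∃ σ ⊆ Ωᶜ, IsCompact σ ∧ IsPreconnected σ ∧ a ∈ σ ∧ b ∈ σ ∧ σ ⊆ closedBall a ε) →
      ContinuousOn (extendFrom (ball 0 1) ψ) (closedBall (0 : ℂ) 1) →
      (∀ x ∈ closedBall (0 : ℂ) 1, Tendsto ψ (𝓝[ball 0 1] x) (𝓝 (extendFrom (ball 0 1) ψ x))) →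
      0 < r → D.carrier \ F ⊆ Ω →
      ∀ w ∈ frontier D.carrier, Disjoint (ball w r) F →
        w ∈ frontier Ω ∧ (sphere (0 : ℂ) 1 ∩ (extendFrom (ball 0 1) ψ) ⁻¹' {w}).Subsingleton := by
  intro D Ω F ψ r hΩD hΩo hΩb hΩc hlc _hΦc _htend hr hfing w hw hwF
  -- the Schoenflies presentation `D = H(𝔻)`, `∂D = H(∂𝔻)`
  obtain ⟨H, -, -, -, -, -, -, -, -, hHball, hHsph, -⟩ := stub_carvedReduction_jordanApprox D
  have hw' : w ∈ H '' sphere 0 1 := by rw [hHsph]; exact hw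
  obtain ⟨ζ, hζ, rfl⟩ := hw'
  have hζn : ‖ζ‖ = 1 := mem_sphere_zero_iff_norm.1 hζ
  -- near `w`, `Ω` agrees with `D`: `ball w r ∩ D ⊆ D ∖ F ⊆ Ω`
  have hloc' : ball (H ζ) r ∩ D.carrier ⊆ Ω := fun z hz =>
    hfing ⟨hz.2, fun hzF => Set.disjoint_left.1 hwF hz.1 hzF⟩
  have hloc : ball (H ζ) r ∩ H '' ball 0 1 ⊆ Ω := by rw [hHball]; exact hloc'
  have hconn : IsConnected (Ωᶜ \ {H ζ}) :=
    isConnected_compl_diff_of_far hΩc H (by rw [hHball]; exact hΩD) hζn isOpen_ball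
      (mem_ball_self hr) hloc
  refine ⟨?_, stub_carvedReduction_oneSidedInjective Ω ψ (H ζ) hΩo hΩb hlc hconn⟩
  -- `w ∈ ∂Ω = closure Ω ∖ Ω`
  have hwD : H ζ ∉ D.carrier := by
    have h : H ζ ∈ frontier D.carrier := hw
    rw [D.isOpen.frontier_eq] at h
    exact h.2
  rw [hΩo.frontier_eq]
  refine ⟨?_, fun h => hwD (hΩD h)⟩
  rw [Metric.mem_closure_iff]
  intro ε hε
  obtain ⟨b, hbD, hb⟩ :=
    Metric.mem_closure_iff.1 (frontier_subset_closure hw) (min ε r) (lt_min hε hr)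
  exact ⟨b, hloc' ⟨mem_ball'.2 (hb.trans_le (min_le_right _ _)), hbD⟩,
    hb.trans_le (min_le_left _ _)⟩

end Summit.CriticalPhenomena.SAWScalingLimit.Theorems.ObservableToSLER.Squeeze

end
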